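import Mathlib
import HarnessLib
import Summits.HubbardSuperconductivity.HubbardSuperconductivity.Theorems.KLProgrammeKLRegimeSectorSliceRowsMomentGeneric

/-!
# Route `KLProgramme` — engine support (route (L2), FIRST MOMENT, cure (c-D)): TELESCOPING the sectorised counterterm slice covariance over a chain of
# frames and the subadditivity of its weighted row / column sums

Cell `gate-hubbard-kl`, seat hubbard-kl-k3c3-p2 (g8), for the ENGINE child stmt-HubbardSuperconductivity-20437 (`stub_engine_step_norms`, WEIGHTED lines at
internal levels; v2 conditional token #19; located risk «(b)-Wt@j≥1», evidence #48 CD-LIMITS).  The weighted rows `hrow` of the slice covariance at the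
flow frame `K_n` are bounded piece by piece (Benfatto–Giuliani–Mastropietro 2006 §3 (3.2)–(3.8)): with a chain of frames `K(m₀), K(m₀+1), …, K(n)`,

* §1 **`sectorSliceCT_telescope`** — `Sᵀ C^{K(n)} S = Sᵀ C^{K(m₀)} S + Σ_{i < n−m₀} Sᵀ (C^{K(m₀+i+1)} − C^{K(m₀+i)}) S` (matrix algebra);
* §2 **`rowSumWt_norm_add_sum_le`** / **`colSumWt_norm_add_sum_le`** — the weighted row/column sums of `A + Σ_i B_i` are at most those of `A` plus the sum
  of those of the `B_i` (nonnegative weight);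
* §3 **`rowSumWt_norm_sectorSliceCT_le_telescope`** / **`colSumWt_…`** — hence the weighted rows/columns of `Sᵀ C^{K(n)} S` are bounded by the BASE
  term (`…SectorSliceRowsMoment`, frame `K(m₀)`) plus the sum over the INCREMENT terms (`…SectorSliceRowsMomentGeneric` with
  `hubbardCovSliceCT_sub_eq_normalCovariance`), each `8·Σ_{ω′} T_w(·)` — the per-pair quantities bounded by `…SectorSlicePairMoment` /
  `…SectorSliceIncrPairMoment`.

Everything is proved; no definitions, no named facts. [folklore]

References: G. Benfatto, A. Giuliani, V. Mastropietro, Ann. Henri Poincaré 7 (2006) 809–898, §2.7 (2.66)–(2.67), §3 (3.2)–(3.8).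
-/

noncomputable section

namespace Summit.HubbardSuperconductivity.HubbardSuperconductivity.Theorems.TorusFourierL2

set_option linter.dupNamespace false -- summit = problem name (single-conjunct summit), D-0017

open Finset Complex Literature.MathematicalPhysics.QuantumLattice Literature.Probability.LatticeModels
open scoped Real

/-! ### §1 Telescoping over a chain of frames -/

section Telescope

variable {L M N : ℕ} [NeZero L] [NeZero M]

omit [NeZero M] in
/-- **Telescoping of the sectorised CT slice covariance over a chain of frames** `K : ℕ → frames`, from `m₀` to `m₀ + d`:
`Sᵀ C^{K(m₀+d)} S = Sᵀ C^{K(m₀)} S + Σ_{i<d} Sᵀ (C^{K(m₀+i+1)} − C^{K(m₀+i)}) S`. [cite: BenfattoGiulianiMastropietro2006, §3 (3.3)] -/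
theorem sectorSliceCT_telescope (β μ Λ Λ' : ℝ) (F : Fin N → FreqMomentum L M → ℂ) (K : ℕ → TrigPolyC4v) (m₀ d : ℕ) :
    (sectorSubMatrix L M β F).transpose * hubbardCovSliceCT L M β μ 0 (K (m₀ + d)) Λ Λ' * sectorSubMatrix L M β F =
      (sectorSubMatrix L M β F).transpose * hubbardCovSliceCT L M β μ 0 (K m₀) Λ Λ' * sectorSubMatrix L M β F +
        ∑ i ∈ range d, (sectorSubMatrix L M β F).transpose *
          (hubbardCovSliceCT L M β μ 0 (K (m₀ + i + 1)) Λ Λ' - hubbardCovSliceCT L M β μ 0 (K (m₀ + i)) Λ Λ') * sectorSubMatrix L M β F := by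
  set S := sectorSubMatrix L M β F with hS
  set C : ℕ → Matrix (HubbardFieldIdx L M) (HubbardFieldIdx L M) ℂ := fun i => hubbardCovSliceCT L M β μ 0 (K (m₀ + i)) Λ Λ' with hC
  have hsum : ∑ i ∈ range d, S.transpose * (hubbardCovSliceCT L M β μ 0 (K (m₀ + i + 1)) Λ Λ' - hubbardCovSliceCT L M β μ 0 (K (m₀ + i)) Λ Λ') * S =
      ∑ i ∈ range d, (S.transpose * C (i + 1) * S - S.transpose * C i * S) := by
    refine sum_congr rfl fun i _ => ?_
    rw [hC]; dsimp only
    rw [show m₀ + (i + 1) = m₀ + i + 1 by ring, Matrix.mul_sub, Matrix.sub_mul]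
  rw [hsum, Finset.sum_range_sub (fun i => S.transpose * C i * S) d, hC]
  dsimp only
  rw [add_zero]
  abel

end Telescope

/-! ### §2 Weighted row / column sums are subadditive -/

section Subadd

variable {ι α : Type*} [Fintype α]

/-- **Weighted row sums of `A + Σ_i B_i`** (nonnegative weight): `Σ_{y} ‖(A + Σ_i B_i) x y‖·w x y ≤ Σ_y ‖A x y‖·w x y + Σ_i Σ_y ‖B_i x y‖·w x y`.
[folklore] -/
theorem rowSumWt_norm_add_sum_le (s : Finset ι) (A : Matrix α α ℂ) (B : ι → Matrix α α ℂ) (w : α → α → ℝ) (hw : ∀ x y, 0 ≤ w x y)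
    (x : α) :
    ∑ y, ‖(A + ∑ i ∈ s, B i) x y‖ * w x y ≤ ∑ y, ‖A x y‖ * w x y + ∑ i ∈ s, ∑ y, ‖B i x y‖ * w x y := by
  classical
  rw [Finset.sum_comm (s := s), ← Finset.sum_add_distrib]
  refine Finset.sum_le_sum fun y _ => ?_
  rw [← Finset.sum_mul, ← add_mul]
  refine mul_le_mul_of_nonneg_right ?_ (hw x y)
  rw [Matrix.add_apply, Matrix.sum_apply]
  exact (norm_add_le _ _).trans (add_le_add le_rfl (norm_sum_le _ _))

/-- **Weighted column sums of `A + Σ_i B_i`** (nonnegative weight). [folklore] -/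
theorem colSumWt_norm_add_sum_le (s : Finset ι) (A : Matrix α α ℂ) (B : ι → Matrix α α ℂ) (w : α → α → ℝ) (hw : ∀ x y, 0 ≤ w x y)
    (y : α) :
    ∑ x, ‖(A + ∑ i ∈ s, B i) x y‖ * w x y ≤ ∑ x, ‖A x y‖ * w x y + ∑ i ∈ s, ∑ x, ‖B i x y‖ * w x y := by
  classical
  rw [Finset.sum_comm (s := s), ← Finset.sum_add_distrib]
  refine Finset.sum_le_sum fun x _ => ?_
  rw [← Finset.sum_mul, ← add_mul]
  refine mul_le_mul_of_nonneg_right ?_ (hw x y)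
  rw [Matrix.add_apply, Matrix.sum_apply]
  exact (norm_add_le _ _).trans (add_le_add le_rfl (norm_sum_le _ _))

end Subadd

/-! ### §3 The weighted rows of `Sᵀ C^{K(n)} S`: base + increments, each reduced to per-pair character sums -/

section Rows

variable {L M N : ℕ} [NeZero L] [NeZero M]

/-- **Weighted row sums of the sectorised CT slice covariance at the END of a chain of frames** are bounded by the base term plus the increments,
each reduced to weighted per-pair character sums: for every nonnegative even weight `w` on the product torus and `Y = (x, ((ω,σ),c))`,
`Σ_{Y'} ‖(Sᵀ C^{K(m₀+d)} S) Y Y'‖·w(x−x′) ≤ 8Σ_{ω′} T_w^{K(m₀)}(ω,ω′) + Σ_{i<d} 8Σ_{ω′} T_w^{Δ,i}(ω,ω′)` with the base pair symbol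
`(βL²)⁻²F_ωF_{ω′}Ψ̂(e_{K(m₀)})` and the increment pair symbols `(βL²)⁻²F_ωF_{ω′}(Ψ̂(e_{K(m₀+i+1)}) − Ψ̂(e_{K(m₀+i)}))`.
[cite: BenfattoGiulianiMastropietro2006, §2.7 (2.66)–(2.67), §3 (3.3)] -/
theorem rowSumWt_norm_sectorSliceCT_le_telescope {β : ℝ} (hβ : β ≠ 0) (μ Λ Λ' : ℝ) (F : Fin N → FreqMomentum L M → ℂ)
    (K : ℕ → TrigPolyC4v) (m₀ d : ℕ) (w : TorusSite 1 (2 * M) × TorusSite 2 L → ℝ) (hw0 : ∀ z, 0 ≤ w z)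
    (hw : ∀ a b, w (-a, -b) = w (a, b)) (Y : SpaceTimeIdx L M × SectorLeg N) :
    ∑ Y' : SpaceTimeIdx L M × SectorLeg N,
        ‖((sectorSubMatrix L M β F).transpose * hubbardCovSliceCT L M β μ 0 (K (m₀ + d)) Λ Λ' * sectorSubMatrix L M β F) Y Y'‖ *
          w ((fun _ : Fin 1 => ((Y.1.1 : ℕ) : ZMod (2 * M)) - ((Y'.1.1 : ℕ) : ZMod (2 * M))), Y.1.2 - Y'.1.2) ≤
      8 * ∑ ω' : Fin N, ∑ z : TorusSite 1 (2 * M) × TorusSite 2 L, w z *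
        ‖∑ q : TorusSite 1 (2 * M) × TorusSite 2 L, (torusChar q.1 z.1 * torusChar q.2 z.2) •
          ((((1 / (β * (L : ℝ) ^ 2) : ℝ) : ℂ) ^ 2 *
            (F Y.2.1.1 (⟨(q.1 0).val, ZMod.val_lt (q.1 0)⟩, q.2) * F ω' (⟨(q.1 0).val, ZMod.val_lt (q.1 0)⟩, q.2) *
              sliceSymbolFnXi (β * (L : ℝ) ^ 2) 0 Λ Λ' (matsubaraFreq β M ⟨(q.1 0).val, ZMod.val_lt (q.1 0)⟩)
                (nambuXiCT L μ (K m₀) q.2))))‖ +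
      ∑ i ∈ range d, 8 * ∑ ω' : Fin N, ∑ z : TorusSite 1 (2 * M) × TorusSite 2 L, w z *
        ‖∑ q : TorusSite 1 (2 * M) × TorusSite 2 L, (torusChar q.1 z.1 * torusChar q.2 z.2) •
          ((((1 / (β * (L : ℝ) ^ 2) : ℝ) : ℂ) ^ 2 *
            (F Y.2.1.1 (⟨(q.1 0).val, ZMod.val_lt (q.1 0)⟩, q.2) * F ω' (⟨(q.1 0).val, ZMod.val_lt (q.1 0)⟩, q.2) *
              (sliceSymbolFnXi (β * (L : ℝ) ^ 2) 0 Λ Λ' (matsubaraFreq β M ⟨(q.1 0).val, ZMod.val_lt (q.1 0)⟩)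
                  (nambuXiCT L μ (K (m₀ + i + 1)) q.2) -
                sliceSymbolFnXi (β * (L : ℝ) ^ 2) 0 Λ Λ' (matsubaraFreq β M ⟨(q.1 0).val, ZMod.val_lt (q.1 0)⟩)
                  (nambuXiCT L μ (K (m₀ + i)) q.2)))))‖ := by
  classical
  rw [sectorSliceCT_telescope β μ Λ Λ' F K m₀ d]
  refine (rowSumWt_norm_add_sum_le (range d) _ _
    (fun (Y Y' : SpaceTimeIdx L M × SectorLeg N) =>
      w ((fun _ : Fin 1 => ((Y.1.1 : ℕ) : ZMod (2 * M)) - ((Y'.1.1 : ℕ) : ZMod (2 * M))), Y.1.2 - Y'.1.2)) (fun _ _ => hw0 _) Y).trans ?_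
  refine add_le_add (rowSumWt_norm_pullback_sliceCT_le hβ μ (K m₀) Λ Λ' F w hw0 hw Y) (Finset.sum_le_sum fun i _ => ?_)
  rw [hubbardCovSliceCT_sub_eq_normalCovariance hβ μ (K (m₀ + i)) (K (m₀ + i + 1)) Λ Λ']
  exact rowSumWt_norm_pullback_normalCovariance_le hβ (fun ω k =>
    sliceSymbolFnXi (β * (L : ℝ) ^ 2) 0 Λ Λ' ω (nambuXiCT L μ (K (m₀ + i + 1)) k) -
      sliceSymbolFnXi (β * (L : ℝ) ^ 2) 0 Λ Λ' ω (nambuXiCT L μ (K (m₀ + i)) k)) F w hw0 hw Y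

/-- **Weighted column sums at the end of a chain of frames**: base + increments (the symbol read at the column's spin `σ′`, it is spin-independent).
[cite: BenfattoGiulianiMastropietro2006, §2.7 (2.66)–(2.67), §3 (3.3)] -/
theorem colSumWt_norm_sectorSliceCT_le_telescope {β : ℝ} (hβ : β ≠ 0) (μ Λ Λ' : ℝ) (F : Fin N → FreqMomentum L M → ℂ)
    (K : ℕ → TrigPolyC4v) (m₀ d : ℕ) (w : TorusSite 1 (2 * M) × TorusSite 2 L → ℝ) (hw0 : ∀ z, 0 ≤ w z)
    (hw : ∀ a b, w (-a, -b) = w (a, b)) (Y' : SpaceTimeIdx L M × SectorLeg N) :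
    ∑ Y : SpaceTimeIdx L M × SectorLeg N,
        ‖((sectorSubMatrix L M β F).transpose * hubbardCovSliceCT L M β μ 0 (K (m₀ + d)) Λ Λ' * sectorSubMatrix L M β F) Y Y'‖ *
          w ((fun _ : Fin 1 => ((Y.1.1 : ℕ) : ZMod (2 * M)) - ((Y'.1.1 : ℕ) : ZMod (2 * M))), Y.1.2 - Y'.1.2) ≤
      8 * ∑ ω : Fin N, ∑ z : TorusSite 1 (2 * M) × TorusSite 2 L, w z *
        ‖∑ q : TorusSite 1 (2 * M) × TorusSite 2 L, (torusChar q.1 z.1 * torusChar q.2 z.2) •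
          ((((1 / (β * (L : ℝ) ^ 2) : ℝ) : ℂ) ^ 2 *
            (F ω (⟨(q.1 0).val, ZMod.val_lt (q.1 0)⟩, q.2) * F Y'.2.1.1 (⟨(q.1 0).val, ZMod.val_lt (q.1 0)⟩, q.2) *
              sliceSymbolFnXi (β * (L : ℝ) ^ 2) 0 Λ Λ' (matsubaraFreq β M ⟨(q.1 0).val, ZMod.val_lt (q.1 0)⟩)
                (nambuXiCT L μ (K m₀) q.2))))‖ +
      ∑ i ∈ range d, 8 * ∑ ω : Fin N, ∑ z : TorusSite 1 (2 * M) × TorusSite 2 L, w z *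
        ‖∑ q : TorusSite 1 (2 * M) × TorusSite 2 L, (torusChar q.1 z.1 * torusChar q.2 z.2) •
          ((((1 / (β * (L : ℝ) ^ 2) : ℝ) : ℂ) ^ 2 *
            (F ω (⟨(q.1 0).val, ZMod.val_lt (q.1 0)⟩, q.2) * F Y'.2.1.1 (⟨(q.1 0).val, ZMod.val_lt (q.1 0)⟩, q.2) *
              (sliceSymbolFnXi (β * (L : ℝ) ^ 2) 0 Λ Λ' (matsubaraFreq β M ⟨(q.1 0).val, ZMod.val_lt (q.1 0)⟩)
                  (nambuXiCT L μ (K (m₀ + i + 1)) q.2) -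
                sliceSymbolFnXi (β * (L : ℝ) ^ 2) 0 Λ Λ' (matsubaraFreq β M ⟨(q.1 0).val, ZMod.val_lt (q.1 0)⟩)
                  (nambuXiCT L μ (K (m₀ + i)) q.2)))))‖ := by
  classical
  rw [sectorSliceCT_telescope β μ Λ Λ' F K m₀ d]
  refine (colSumWt_norm_add_sum_le (range d) _ _
    (fun (Y Y' : SpaceTimeIdx L M × SectorLeg N) =>
      w ((fun _ : Fin 1 => ((Y.1.1 : ℕ) : ZMod (2 * M)) - ((Y'.1.1 : ℕ) : ZMod (2 * M))), Y.1.2 - Y'.1.2)) (fun _ _ => hw0 _) Y').trans ?_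
  refine add_le_add (colSumWt_norm_pullback_sliceCT_le hβ μ (K m₀) Λ Λ' F w hw0 hw Y') (Finset.sum_le_sum fun i _ => ?_)
  rw [hubbardCovSliceCT_sub_eq_normalCovariance hβ μ (K (m₀ + i)) (K (m₀ + i + 1)) Λ Λ']
  exact colSumWt_norm_pullback_normalCovariance_le hβ (fun ω k =>
    sliceSymbolFnXi (β * (L : ℝ) ^ 2) 0 Λ Λ' ω (nambuXiCT L μ (K (m₀ + i + 1)) k) -
      sliceSymbolFnXi (β * (L : ℝ) ^ 2) 0 Λ Λ' ω (nambuXiCT L μ (K (m₀ + i)) k)) F w hw0 hw Y'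

end Rows

end Summit.HubbardSuperconductivity.HubbardSuperconductivity.Theorems.TorusFourierL2

end
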